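import Summits.QuantumFields.BalabanUV.T4Continuum.Support.NE7ApeTrivialFlatEndSkewBudget
import Summits.QuantumFields.BalabanUV.T4Continuum.Support.NE7FlatSliceEnd
import Summits.QuantumFields.BalabanUV.T4Continuum.Support.NE7CornerGaugeRegauge
import Summits.QuantumFields.BalabanUV.T4Continuum.Support.NE7CornerOscillationLetter
import HarnessLib

/-!
# NE7ApeTrivialFlatEndDischarged — THE (APE) BOOTSTRAP AT THE TRIVIAL FLAT DATUM WITH ITS DISCHARGEABLE LETTERS DISCHARGED: the slice-solver letter G♭
# by (152) `NE7FlatSliceEnd.sliceSolver_end_holds`, REP♭'s top normalisation `hflatTop` by the corner-gauge re-gauging (154f)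
# `NE7CornerGaugeRegauge.exists_regauge_flatTop`, and the corner-oscillation letter by (154g) `NE7CornerOscillationLetter.corner_oscillation_le` —
# composed over the OWNER's tree END F55b `NE7ApeTrivialFlatEndSkewBudget.smallField_of_trivialLetters_currency_skew` (G♭ on the skew slice)

Cell `pub-balaban`, rung (B)+1 sub-cell t4, row NE7.  Lineage `b2b-balaban-t4-ne7-p2` (CRUX PROVER NE7 #2 = co-owner of row NE7), generation 87; the three
theorems were drafted and certified as END draft sections §5 (gen 85, v4) and §6 ∕ §7 (gen 86, v5 ∕ v6) for the OWNER's F54 and are here RE-BASED, byte for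
byte but for the name of the consumed END theorem, on the OWNER's (lineage `b2b-balaban-t4-ne7-p1`, gen 72) tree file F55b `NE7ApeTrivialFlatEndSkewBudget`
— whose `{K} (hK) (hG)` binder, asked on the SKEW slice (the NE7 desk's E-62-1 ∕ E-75-4 repair R1 + R1b), is character for character the conclusion of (152).
WHY.  After F55b, THE END displays as hypotheses: the class data of `U` + tangent-criticality `hcritU`; REP♭ = a gauge `u` and a skew periodic representative `A`
with `U^u = e^{A}`, sup ∕ gradient currencies AND the top normalisation `cavgIter L (k+1) e^{A} = 1`; G♭ with constant `K·M`; numeric lines.  Of these, G♭ and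
the top normalisation are TREE THEOREMS of this lineage ((137)–(152); (154a–g)), so THE END can be re-issued without them.
WHAT ([folklore] composition BY NAME; 0 def, 0 sorry; three theorems, dimension `d + 1`, `n : Type`):
* §1 **`smallField_of_trivialLetters_discharged`** — F55b's `smallField_of_trivialLetters_currency_skew` with `{K} (hK) (hG)` SUPPLIED by
  `NE7FlatSliceEnd.sliceSolver_end_holds` (`∃ K ≥ 0`, free of `k` and `N`, over lit-balaban `B5G115SupBound` + GAN24 `Entry115SupCubic` ∕
  `AveragedPropagatorInverseUniform`): G♭ is NO LONGER a hypothesis.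
* §2 **`smallField_of_trivialLetters_regauged`** — the posited representative data `(u, A, hu, huP, hgauge, hA, hAP, hAα, hA1, hflatTop)` REPLACED by the FIBRE
  CONSTRAINT `hflatTopU : cavgIter L (k+1) U = 1` on the background, B8's output over it (`u₀` unitary periodic, `U^{u₀} = vary 1 A₀ 1`, `A₀` periodic,
  `‖A₀‖ ≤ a₀`, `‖∇A₀‖ ≤ a₁`), the corner-oscillation letter `ω` (`300(d+1)ω ≤ 1`, `e^{a₀} − 1 + 8ω∕M ≤ 1∕4`) and two lower bounds tying `α₀, α₁` to
  `(a₀, a₁, ω)` — the six numeric lines verbatim — via `NE7CornerGaugeRegauge.exists_regauge_flatTop` (`u := w·u₀`, `A := log U^u` skew periodic with flat top).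
* §3 **`smallField_of_trivialLetters_final`** — `ω` DERIVED: any `ω ≥ M(e^{a₀} − 1) + 136(d+2)(d+5)·M²·(δ∕M²)` works (`δ∕M² ≤ x`), by
  `NE7CornerOscillationLetter.corner_oscillation_le`.  NET: THE END asks of the admissible `U` ONLY unitarity, the multi-level small-field class at radii `x` and
  `δ∕M²`, the fibre constraint, tangent-criticality on the fibre, B8's output `(u₀, A₀, a₀, a₁)` over it — B8 Theorem 2 TYPE, a HYPOTHESIS — and numeric lines.
HONEST FRAMING (page 1): composition BY NAME of tree theorems (the OWNER's F55a ∕ F55b and their parents F36–F53; this lineage's (137)–(152) and (154a–g); row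
NE3's tower letters; lit-balaban ∕ GAN24 kernel theorems); B8's output `(u₀, A₀, a₀, a₁)` and `hcritU` remain HYPOTHESES (B8 Theorem 2 TYPE ∕ the object's
definition); the numeric lines are displayed smallness CONDITIONS; constants not optimised; ONE datum (the trivial flat one), not F31's `hape` on the data class;
(APE) NOT proved unconditionally; NOT ONE-STEP, NOT NE7; NE7 NOT PRINTED ∕ NOT PROVED; spine 0∕9; FIXED FINITE T⁴, rung (B)+1 — NOT infinite volume, NOT mass
gap, NOT Clay.  Continuum YM on T⁴ ⇐ BetaPertH ∧ nine spine estimates (0/9 proved); BetaPertH ⇐ (D1) ∧ (D4) ∧ CAP+tail; G-an2-4 gates asym, D1 and NE2/3/4.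
No `sorry`.  PLACEMENT: our lemma, under `Summits/QuantumFields/BalabanUV/`.
RE-FILED by the OWNER lineage `b2b-balaban-t4-ne7-p1` gen 72 (2026-08-25) after p393132 (t4-ne7-p2 gen 87) BOUNCED on `failed to synthesize Norm (Matrix n n ℂ)`:
the ONLY change to gen 87's bytes is the two `open` lines after `set_option autoImplicit false` (the scoped `Matrix.Norms.L2Operator` norm instance and
`BigOperators`), as in F55b's header; all three theorems, their statements and proofs are t4-ne7-p2 gen 87's, byte for byte (their offer [NE7P2-G87-INBOX-2]).
-/

set_option autoImplicit false

open scoped BigOperators Matrix.Norms.L2Operator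
open NormedSpace Finset

/-! ## §1 (= END draft §5, t4-ne7-p2 gen 85; re-based by gen 87 on the OWNER's tree theorem F55b `NE7ApeTrivialFlatEndSkewBudget.smallField_of_trivialLetters_currency_skew`)
## THE END WITH G♭ DISCHARGED: `hK` ∕ `hG` supplied by (152) `NE7FlatSliceEnd.sliceSolver_end_holds` -/

namespace Summit.QuantumFields.BalabanUV.T4Continuum.NE7ApeTrivialFlatEndDischarged

open Literature.MathematicalPhysics.QuantumFieldTheory.Balaban1983to89
open B7Prop1Explicit B7Prop2Explicit MatrixLog UnitaryModel
open T4AveragingDeficitWall (IsUnitaryCfg IsSkewDir SmallField vary curlAt dirL1)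
open T4AveragingDeficitWallBoundary (IsPeriodicCfg periodBox)
open AveragingDeficitPeriodicCounting (IsPeriodicDir)
open AveragingDeficitMultiLevelPrep (cavgIter LevelSmall)
open MinimalActionLevels (perWin)
open BlockAveragePushDirSplit (flat)
open BlockAverageVaryHolo (nbRad)
open BlockAverageVaryDisc (rho0)
open B4Sect5Proof (latticeConst)
open B5Hk163Strip (kappa163)
open B5Hk163TorusHolderDecay (CdecD)
open NE3HessForm (hess dAction)
open NE3TangentCovariantTower (dirIter)
open NE3QbarIterCovLiftPrep (cruxC)
open NE3RightInverseSolveLetters (thetaLoc)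
open NE3HatInvCurlLetters (curl1C)
open NE3EnergyShapes (IsUnitarySite)
open NE7ApeTrivialFlatEndSkewBudget (smallField_of_trivialLetters_currency_skew)

noncomputable section

variable {d : ℕ}

/-- **THE END AT THE TRIVIAL FLAT DATUM WITH THE SLICE-SOLVER LETTER DISCHARGED** (over the OWNER's F55b): for every `d ≥ 1`, `L ≥ 2` and every
`n : Type` there is `K ≥ 0` — free of `k` and `N`, namely (152)'s `(1 + 2(d+1)·C_fr(d+1,L))·2(card n)³·K(d)` — such that for ALL `N ≥ 1`, `k` and all
data of `NE7ApeTrivialFlatEndSkewBudget.smallField_of_trivialLetters_currency_skew` EXCEPT its pair `{K} (hK) (hG)`, the same conclusion holds: the (APE) bootstrap inequality at the trivial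
datum now displays ONLY the representative's data (REP♭: `hu`, `huP`, `hgauge`, `hA…`, `hflatTop`), tangent-criticality `hcritU`, the class ∕ plaquette radii
and the six numeric smallness lines.  `hG` is the tree theorem `NE7FlatSliceEnd.sliceSolver_end_holds` (lineage t4-ne7-p2 gen 84, modules 137–152, over
lit-balaban `B5G115SupBound` + GAN24 `Entry115SupCubic` ∕ `AveragedPropagatorInverseUniform`).  `n : Type` (universe 0) because (152) is stated there. [folklore] -/
theorem smallField_of_trivialLetters_discharged {n : Type} [Fintype n] [DecidableEq n] [Nonempty n] (hd : 1 ≤ d) {L : ℕ} (hL : 2 ≤ L) :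
    ∃ K : ℝ, 0 ≤ K ∧ ∀ (N : ℕ) [NeZero N] (k : ℕ)
    {U : Site (d + 1) → Fin (d + 1) → (Matrix n n ℂ)ˣ} (hU : IsUnitaryCfg U) {x δ : ℝ} (hx : 0 ≤ x) (hs : LevelSmall (d + 1) L k x)
    (hUx : SmallField U x) (hδ : 0 ≤ δ) (hUδ : SmallField U (δ / ((L : ℝ) ^ (k + 1)) ^ 2))
    (hcritU : ∀ φ : Site (d + 1) → Fin (d + 1) → Matrix n n ℂ, IsSkewDir φ → IsPeriodicDir φ ((L ^ (k + 1) * N : ℕ) : ℤ) →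
      dirIter L (k + 1) U φ = 0 → dAction U φ (perWin (d + 1) (L ^ (k + 1) * N)) = 0)
    {u : Site (d + 1) → (Matrix n n ℂ)ˣ} (hu : IsUnitarySite u) (huP : ∀ (y : Site (d + 1)) (i : Fin (d + 1)), u (y + (((L ^ (k + 1) * N : ℕ) : ℤ)) • e i) = u y)
    {A : Site (d + 1) → Fin (d + 1) → Matrix n n ℂ} (hgauge : gaugeAct u U = vary (flat (d := d + 1) (n := n)) A 1)
    (hA : IsSkewDir A) (hAP : IsPeriodicDir A ((L ^ (k + 1) * N : ℕ) : ℤ))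
    {α₀ α₁ αh1 : ℝ} (hα₀ : 0 ≤ α₀) (hα₁ : 0 ≤ α₁) (hAα : ∀ (y : Site (d + 1)) (κ : Fin (d + 1)), ‖A y κ‖ ≤ α₀)
    (hA1 : ∀ (y : Site (d + 1)) (κ τ : Fin (d + 1)), ‖A (y + e τ) κ - A y κ‖ ≤ α₁) (hα₁h : α₁ ≤ αh1 / ((L : ℝ) ^ (k + 1)) ^ 2)
    (hθ : cruxC (d + 1) L * (((L : ℝ) ^ (k + 1)) ^ 2 * x) < 1) (hθl : thetaLoc (d + 1) L * (((L : ℝ) ^ (k + 1)) ^ 2 * x) < 1)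
    (hε : ((L : ℝ) ^ (k + 1)) ^ 2 * x ≤ 1)
    (hσ : 4 * (3 + 12 * ((d + 1 : ℕ) : ℝ)) ^ 2 * (L : ℝ) ^ (k + 1) * α₀ ≤ rho0 (d + 1) L ^ 2)
    (hS1 : (8 * (3 + 12 * ((d + 1 : ℕ) : ℝ)) * (2 + 2 * ((((d + 1 : ℕ) : ℝ) + 1) * L)
        * (1 + ((1250 * ((nbRad (d + 1) L : ℝ) + L) + 8 * (((d + 1 : ℕ) : ℝ) * L) + 2 * L) * (((d + 1 : ℕ) : ℝ) * (2 * nbRad (d + 1) L + 1) ^ (d + 1)))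
            / ((L : ℝ) / (L : ℝ) ^ (d + 1))))) * ((L : ℝ) ^ (k + 1) * α₀) ≤ 1)
    (hb : 256 * (((d + 1 : ℕ) : ℝ) + 1) * L * (3 + 12 * ((d + 1 : ℕ) : ℝ)) * ((L : ℝ) ^ (k + 1) * α₀) ≤ 1)
    (hflatTop : cavgIter L (k + 1) (vary (flat (d := d + 1) (n := n)) A 1) = flat),
    SmallField U
      ((K * (2 * (curl1C (d + 1) L / (1 - thetaLoc (d + 1) L * (((L : ℝ) ^ (k + 1)) ^ 2 * x)))
                * (8 * (3 + 12 * ((d + 1 : ℕ) : ℝ)) * (2 + 2 * ((((d + 1 : ℕ) : ℝ) + 1) * L)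
                  * (1 + ((1250 * ((nbRad (d + 1) L : ℝ) + L) + 8 * (((d + 1 : ℕ) : ℝ) * L) + 2 * L)
                      * (((d + 1 : ℕ) : ℝ) * (2 * nbRad (d + 1) L + 1) ^ (d + 1))) / ((L : ℝ) / (L : ℝ) ^ (d + 1)))))
                * δ * ((L : ℝ) ^ (k + 1) * α₀)
              + (Fintype.card (T4AveragingDeficitWall.Plane (d + 1)) : ℝ)
                * (144 * (((L : ℝ) ^ (k + 1) * α₀) * αh1) + 5440 * ((L : ℝ) ^ (k + 1) * α₀) ^ 3 + 8 * (αh1 * αh1)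
                    + 304 * (αh1 * ((L : ℝ) ^ (k + 1) * α₀) ^ 2) + 2688 * ((L : ℝ) ^ (k + 1) * α₀) ^ 4))
          + Fintype.card n * (2 * (CdecD d * (((d : ℝ) + 1) * (2 * ((d : ℝ) + 1))
              * ((2 + 32 / (kappa163 (d + 1) / (d + 1)) ^ 2) * latticeConst (d + 1) (kappa163 (d + 1) / (d + 1) / 2)))))
            * (0 + 28 * ((3 + 12 * ((d + 1 : ℕ) : ℝ)) * ((L : ℝ) ^ (k + 1) * α₀)
                  + 4 * (3 + 12 * ((d + 1 : ℕ) : ℝ)) ^ 3 / rho0 (d + 1) L ^ 2 * ((L : ℝ) ^ (k + 1) * α₀) ^ 2) ^ 2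
                + 4 * (4 * (3 + 12 * ((d + 1 : ℕ) : ℝ)) ^ 3 / rho0 (d + 1) L ^ 2 * ((L : ℝ) ^ (k + 1) * α₀) ^ 2))
          + 28 * ((L : ℝ) ^ (k + 1) * α₀) ^ 2)
        / ((L : ℝ) ^ (k + 1)) ^ 2) := by
  obtain ⟨K, hK, hG⟩ := NE7FlatSliceEnd.sliceSolver_end_holds (n := n) d hd hL
  refine ⟨K, hK, ?_⟩
  intro N _ k U hU x δ hx hs hUx hδ hUδ hcritU u hu huP A hgauge hA hAP α₀ α₁ αh1 hα₀ hα₁ hAα hA1 hα₁h hθ hθl hε hσ hS1 hb hflatTop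
  exact smallField_of_trivialLetters_currency_skew hL k hU hx hs hUx hδ hUδ hcritU hu huP hgauge hA hAP hα₀ hα₁ hAα hA1 hα₁h hθ hθl hε hσ hS1 hb
    hflatTop hK (hG N k)

end

end Summit.QuantumFields.BalabanUV.T4Continuum.NE7ApeTrivialFlatEndDischarged

/-! ## §2 (= END draft §6, t4-ne7-p2 gen 86) THE END WITH `hflatTop` DISCHARGED: the representative is RE-GAUGED to the fibre by
(154f) `NE7CornerGaugeRegauge.exists_regauge_flatTop` — the flat-top clause becomes the FIBRE CONSTRAINT `cavgIter L (k+1) U = 1` on the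
background plus the corner-oscillation letter `ω` of B8's gauge `u₀` -/

namespace Summit.QuantumFields.BalabanUV.T4Continuum.NE7ApeTrivialFlatEndDischarged

open Literature.MathematicalPhysics.QuantumFieldTheory.Balaban1983to89
open B7Prop1Explicit B7Prop2Explicit MatrixLog UnitaryModel
open T4AveragingDeficitWall (IsUnitaryCfg IsSkewDir SmallField vary curlAt dirL1)
open T4AveragingDeficitWallBoundary (IsPeriodicCfg periodBox)
open AveragingDeficitPeriodicCounting (IsPeriodicDir)
open AveragingDeficitMultiLevelPrep (cavgIter LevelSmall)
open MinimalActionLevels (perWin)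
open BlockAveragePushDirSplit (flat)
open BlockAverageVaryHolo (nbRad)
open BlockAverageVaryDisc (rho0)
open B4Sect5Proof (latticeConst)
open B5Hk163Strip (kappa163)
open B5Hk163TorusHolderDecay (CdecD)
open NE3HessForm (hess dAction)
open NE3TangentCovariantTower (dirIter)
open NE3QbarIterCovLiftPrep (cruxC)
open NE3RightInverseSolveLetters (thetaLoc)
open NE3HatInvCurlLetters (curl1C)
open NE3EnergyShapes (IsUnitarySite)
open NE7CornerGaugeRegauge (exists_regauge_flatTop)

noncomputable section

variable {d : ℕ}

/-- **THE END AT THE TRIVIAL FLAT DATUM, RE-GAUGED (v5 = v4 + this theorem): `hflatTop` IS NO LONGER A HYPOTHESIS.**  Same `K` and same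
conclusion as `smallField_of_trivialLetters_discharged`, for data: the background `U` IN THE FIBRE (`cavgIter L (k+1) U = 1`, the block-average
constraint at the trivial datum), B8's small-field gauge `u₀` (unitary, `M·N`-periodic) with `U^{u₀} = vary 1 A₀ 1`, `A₀` `M·N`-periodic,
`‖A₀‖ ≤ a₀`, `‖∇A₀‖ ≤ a₁`, the CORNER OSCILLATION `‖u₀(M(z+e_i)) − u₀(Mz)‖ ≤ ω` with `300·(d+1)·ω ≤ 1`, `e^{a₀} − 1 + 8ω∕M ≤ 1∕4`, and any
`α₀ ≥ 2(e^{a₀} − 1 + 8ω∕M)`, `α₁ ≥ (4∕3)(e^{a₀}a₁ + 2(8ω∕M)(e^{a₀} − 1) + 165ω∕M² + (8ω∕M)²)` carrying the six numeric lines verbatim.  Proof: (154f)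
re-gauges `u₀` to `u := w·u₀` with `u|_{M•ℤ^{d+1}} = 1` (so `cavgIter (U^u) = 1`) and `U^u = vary 1 A 1`, `A` skew periodic with the displayed
currencies; then v4. [folklore] -/
theorem smallField_of_trivialLetters_regauged {n : Type} [Fintype n] [DecidableEq n] [Nonempty n] (hd : 1 ≤ d) {L : ℕ} (hL : 2 ≤ L) :
    ∃ K : ℝ, 0 ≤ K ∧ ∀ (N : ℕ) [NeZero N] (k : ℕ)
    {U : Site (d + 1) → Fin (d + 1) → (Matrix n n ℂ)ˣ} (hU : IsUnitaryCfg U) {x δ : ℝ} (hx : 0 ≤ x) (hs : LevelSmall (d + 1) L k x)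
    (hUx : SmallField U x) (hδ : 0 ≤ δ) (hUδ : SmallField U (δ / ((L : ℝ) ^ (k + 1)) ^ 2))
    (hcritU : ∀ φ : Site (d + 1) → Fin (d + 1) → Matrix n n ℂ, IsSkewDir φ → IsPeriodicDir φ ((L ^ (k + 1) * N : ℕ) : ℤ) →
      dirIter L (k + 1) U φ = 0 → dAction U φ (perWin (d + 1) (L ^ (k + 1) * N)) = 0)
    (hflatTopU : cavgIter L (k + 1) U = flat)
    {u₀ : Site (d + 1) → (Matrix n n ℂ)ˣ} (hu₀ : IsUnitarySite u₀)
    (hu₀P : ∀ (y : Site (d + 1)) (i : Fin (d + 1)), u₀ (y + (((L ^ (k + 1) * N : ℕ) : ℤ)) • e i) = u₀ y)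
    {A₀ : Site (d + 1) → Fin (d + 1) → Matrix n n ℂ} (hgauge₀ : gaugeAct u₀ U = vary (flat (d := d + 1) (n := n)) A₀ 1)
    (hA₀P : IsPeriodicDir A₀ ((L ^ (k + 1) * N : ℕ) : ℤ))
    {a₀ a₁ ω : ℝ} (ha₀ : ∀ (y : Site (d + 1)) (κ : Fin (d + 1)), ‖A₀ y κ‖ ≤ a₀)
    (ha₁ : ∀ (y : Site (d + 1)) (κ τ : Fin (d + 1)), ‖A₀ (y + e τ) κ - A₀ y κ‖ ≤ a₁)
    (hω : ∀ (z : Site (d + 1)) (i : Fin (d + 1)),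
      ‖(u₀ (((L : ℤ) ^ (k + 1)) • (z + e i)) : Matrix n n ℂ) - u₀ (((L : ℤ) ^ (k + 1)) • z)‖ ≤ ω)
    (hωd : 300 * ((d + 1 : ℕ) : ℝ) * ω ≤ 1) (hβ : Real.exp a₀ - 1 + 8 * ω / (L : ℝ) ^ (k + 1) ≤ 1 / 4)
    {α₀ α₁ αh1 : ℝ} (hAα' : 2 * (Real.exp a₀ - 1 + 8 * ω / (L : ℝ) ^ (k + 1)) ≤ α₀)
    (hA1' : 4 / 3 * (Real.exp a₀ * a₁ + 2 * (8 * ω / (L : ℝ) ^ (k + 1)) * (Real.exp a₀ - 1)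
        + 165 * ω / ((L : ℝ) ^ (k + 1)) ^ 2 + (8 * ω / (L : ℝ) ^ (k + 1)) ^ 2) ≤ α₁)
    (hα₁h : α₁ ≤ αh1 / ((L : ℝ) ^ (k + 1)) ^ 2)
    (hθ : cruxC (d + 1) L * (((L : ℝ) ^ (k + 1)) ^ 2 * x) < 1) (hθl : thetaLoc (d + 1) L * (((L : ℝ) ^ (k + 1)) ^ 2 * x) < 1)
    (hε : ((L : ℝ) ^ (k + 1)) ^ 2 * x ≤ 1)
    (hσ : 4 * (3 + 12 * ((d + 1 : ℕ) : ℝ)) ^ 2 * (L : ℝ) ^ (k + 1) * α₀ ≤ rho0 (d + 1) L ^ 2)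
    (hS1 : (8 * (3 + 12 * ((d + 1 : ℕ) : ℝ)) * (2 + 2 * ((((d + 1 : ℕ) : ℝ) + 1) * L)
        * (1 + ((1250 * ((nbRad (d + 1) L : ℝ) + L) + 8 * (((d + 1 : ℕ) : ℝ) * L) + 2 * L) * (((d + 1 : ℕ) : ℝ) * (2 * nbRad (d + 1) L + 1) ^ (d + 1)))
            / ((L : ℝ) / (L : ℝ) ^ (d + 1))))) * ((L : ℝ) ^ (k + 1) * α₀) ≤ 1)
    (hb : 256 * (((d + 1 : ℕ) : ℝ) + 1) * L * (3 + 12 * ((d + 1 : ℕ) : ℝ)) * ((L : ℝ) ^ (k + 1) * α₀) ≤ 1),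
    SmallField U
      ((K * (2 * (curl1C (d + 1) L / (1 - thetaLoc (d + 1) L * (((L : ℝ) ^ (k + 1)) ^ 2 * x)))
                * (8 * (3 + 12 * ((d + 1 : ℕ) : ℝ)) * (2 + 2 * ((((d + 1 : ℕ) : ℝ) + 1) * L)
                  * (1 + ((1250 * ((nbRad (d + 1) L : ℝ) + L) + 8 * (((d + 1 : ℕ) : ℝ) * L) + 2 * L)
                      * (((d + 1 : ℕ) : ℝ) * (2 * nbRad (d + 1) L + 1) ^ (d + 1))) / ((L : ℝ) / (L : ℝ) ^ (d + 1)))))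
                * δ * ((L : ℝ) ^ (k + 1) * α₀)
              + (Fintype.card (T4AveragingDeficitWall.Plane (d + 1)) : ℝ)
                * (144 * (((L : ℝ) ^ (k + 1) * α₀) * αh1) + 5440 * ((L : ℝ) ^ (k + 1) * α₀) ^ 3 + 8 * (αh1 * αh1)
                    + 304 * (αh1 * ((L : ℝ) ^ (k + 1) * α₀) ^ 2) + 2688 * ((L : ℝ) ^ (k + 1) * α₀) ^ 4))
          + Fintype.card n * (2 * (CdecD d * (((d : ℝ) + 1) * (2 * ((d : ℝ) + 1))
              * ((2 + 32 / (kappa163 (d + 1) / (d + 1)) ^ 2) * latticeConst (d + 1) (kappa163 (d + 1) / (d + 1) / 2)))))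
            * (0 + 28 * ((3 + 12 * ((d + 1 : ℕ) : ℝ)) * ((L : ℝ) ^ (k + 1) * α₀)
                  + 4 * (3 + 12 * ((d + 1 : ℕ) : ℝ)) ^ 3 / rho0 (d + 1) L ^ 2 * ((L : ℝ) ^ (k + 1) * α₀) ^ 2) ^ 2
                + 4 * (4 * (3 + 12 * ((d + 1 : ℕ) : ℝ)) ^ 3 / rho0 (d + 1) L ^ 2 * ((L : ℝ) ^ (k + 1) * α₀) ^ 2))
          + 28 * ((L : ℝ) ^ (k + 1) * α₀) ^ 2)
        / ((L : ℝ) ^ (k + 1)) ^ 2) := by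
  obtain ⟨K, hK, h⟩ := smallField_of_trivialLetters_discharged (n := n) hd hL
  refine ⟨K, hK, ?_⟩
  intro N _ k U hU x δ hx hs hUx hδ hUδ hcritU hflatTopU u₀ hu₀ hu₀P A₀ hgauge₀ hA₀P a₀ a₁ ω ha₀ ha₁ hω hωd hβ α₀ α₁ αh1 hAα' hA1'
    hα₁h hθ hθl hε hσ hS1 hb
  have hL1 : 1 ≤ L := by omega
  obtain ⟨u, A, hu, huP, hgauge, hA, hAP, hAα, hA1, hflatTop⟩ :=
    exists_regauge_flatTop (d := d + 1) hL1 k N hU hx hs hUx hflatTopU hu₀ hu₀P hgauge₀ hA₀P ha₀ ha₁ hω hωd hβ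
  have hα₀ : 0 ≤ α₀ := (norm_nonneg _).trans ((hAα 0 0).trans hAα')
  have hα₁ : 0 ≤ α₁ := (norm_nonneg _).trans ((hA1 0 0 0).trans hA1')
  exact h N k hU hx hs hUx hδ hUδ hcritU hu huP hgauge hA hAP hα₀ hα₁ (fun y κ => (hAα y κ).trans hAα')
    (fun y κ τ => (hA1 y κ τ).trans hA1') hα₁h hθ hθl hε hσ hS1 hb hflatTop

end

end Summit.QuantumFields.BalabanUV.T4Continuum.NE7ApeTrivialFlatEndDischarged

/-! ## §3 (= END draft §7, t4-ne7-p2 gen 86) THE END WITH `hflatTop` DISCHARGED AND THE CORNER LETTER DERIVED: by (154g)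
`NE7CornerOscillationLetter.corner_oscillation_le` the corner oscillation of B8's gauge over a fibre point is `≤ M(e^{a₀} − 1) + 136(d+2)(d+5)δ`
(tower run at the plaquette radius `δ∕M²`), so `ω` is any number above that -/

namespace Summit.QuantumFields.BalabanUV.T4Continuum.NE7ApeTrivialFlatEndDischarged

open Literature.MathematicalPhysics.QuantumFieldTheory.Balaban1983to89
open B7Prop1Explicit B7Prop2Explicit MatrixLog UnitaryModel
open T4AveragingDeficitWall (IsUnitaryCfg IsSkewDir SmallField vary curlAt dirL1)
open T4AveragingDeficitWallBoundary (IsPeriodicCfg periodBox)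
open AveragingDeficitPeriodicCounting (IsPeriodicDir)
open AveragingDeficitMultiLevelPrep (cavgIter LevelSmall)
open MinimalActionLevels (perWin)
open BlockAveragePushDirSplit (flat)
open BlockAverageVaryHolo (nbRad)
open BlockAverageVaryDisc (rho0)
open B4Sect5Proof (latticeConst)
open B5Hk163Strip (kappa163)
open B5Hk163TorusHolderDecay (CdecD)
open NE3HessForm (hess dAction)
open NE3TangentCovariantTower (dirIter)
open NE3QbarIterCovLiftPrep (cruxC)
open NE3RightInverseSolveLetters (thetaLoc)
open NE3HatInvCurlLetters (curl1C)
open NE3EnergyShapes (IsUnitarySite)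
open NE7CornerOscillationLetter (corner_oscillation_le)

noncomputable section

variable {d : ℕ}

/-- **THE END AT THE TRIVIAL FLAT DATUM, RE-GAUGED, CORNER LETTER DERIVED (v6 = v5 + this theorem).**  As
`smallField_of_trivialLetters_regauged`, but the corner-oscillation hypothesis `hω` is REPLACED by its value from the data: any
`ω ≥ M(e^{a₀} − 1) + 136(d+2)(d+5)·M²·(δ∕M²)` (`= α̂-sized + 136(d+2)(d+5)δ`), provided the plaquette radius is inside the class radius
(`δ∕M² ≤ x`).  What THE END now asks of the representative is ONLY B8's output (u₀ unitary periodic, `U^{u₀} = vary 1 A₀ 1`, `A₀` periodic,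
`‖A₀‖ ≤ a₀`, `‖∇A₀‖ ≤ a₁`) over a fibre point `U` (`cavgIter L (k+1) U = 1`), plus numeric lines. [folklore] -/
theorem smallField_of_trivialLetters_final {n : Type} [Fintype n] [DecidableEq n] [Nonempty n] (hd : 1 ≤ d) {L : ℕ} (hL : 2 ≤ L) :
    ∃ K : ℝ, 0 ≤ K ∧ ∀ (N : ℕ) [NeZero N] (k : ℕ)
    {U : Site (d + 1) → Fin (d + 1) → (Matrix n n ℂ)ˣ} (hU : IsUnitaryCfg U) {x δ : ℝ} (hx : 0 ≤ x) (hs : LevelSmall (d + 1) L k x)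
    (hUx : SmallField U x) (hδ : 0 ≤ δ) (hUδ : SmallField U (δ / ((L : ℝ) ^ (k + 1)) ^ 2)) (hδx : δ / ((L : ℝ) ^ (k + 1)) ^ 2 ≤ x)
    (hcritU : ∀ φ : Site (d + 1) → Fin (d + 1) → Matrix n n ℂ, IsSkewDir φ → IsPeriodicDir φ ((L ^ (k + 1) * N : ℕ) : ℤ) →
      dirIter L (k + 1) U φ = 0 → dAction U φ (perWin (d + 1) (L ^ (k + 1) * N)) = 0)
    (hflatTopU : cavgIter L (k + 1) U = flat)
    {u₀ : Site (d + 1) → (Matrix n n ℂ)ˣ} (hu₀ : IsUnitarySite u₀)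
    (hu₀P : ∀ (y : Site (d + 1)) (i : Fin (d + 1)), u₀ (y + (((L ^ (k + 1) * N : ℕ) : ℤ)) • e i) = u₀ y)
    {A₀ : Site (d + 1) → Fin (d + 1) → Matrix n n ℂ} (hgauge₀ : gaugeAct u₀ U = vary (flat (d := d + 1) (n := n)) A₀ 1)
    (hA₀P : IsPeriodicDir A₀ ((L ^ (k + 1) * N : ℕ) : ℤ))
    {a₀ a₁ ω : ℝ} (ha₀ : ∀ (y : Site (d + 1)) (κ : Fin (d + 1)), ‖A₀ y κ‖ ≤ a₀)
    (ha₁ : ∀ (y : Site (d + 1)) (κ τ : Fin (d + 1)), ‖A₀ (y + e τ) κ - A₀ y κ‖ ≤ a₁)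
    (hω' : (L : ℝ) ^ (k + 1) * (Real.exp a₀ - 1)
        + 136 * ((((d + 1 : ℕ) : ℝ) + 1) * (((d + 1 : ℕ) : ℝ) + 4)) * (((L : ℝ) ^ (k + 1)) ^ 2 * (δ / ((L : ℝ) ^ (k + 1)) ^ 2)) ≤ ω)
    (hωd : 300 * ((d + 1 : ℕ) : ℝ) * ω ≤ 1) (hβ : Real.exp a₀ - 1 + 8 * ω / (L : ℝ) ^ (k + 1) ≤ 1 / 4)
    {α₀ α₁ αh1 : ℝ} (hAα' : 2 * (Real.exp a₀ - 1 + 8 * ω / (L : ℝ) ^ (k + 1)) ≤ α₀)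
    (hA1' : 4 / 3 * (Real.exp a₀ * a₁ + 2 * (8 * ω / (L : ℝ) ^ (k + 1)) * (Real.exp a₀ - 1)
        + 165 * ω / ((L : ℝ) ^ (k + 1)) ^ 2 + (8 * ω / (L : ℝ) ^ (k + 1)) ^ 2) ≤ α₁)
    (hα₁h : α₁ ≤ αh1 / ((L : ℝ) ^ (k + 1)) ^ 2)
    (hθ : cruxC (d + 1) L * (((L : ℝ) ^ (k + 1)) ^ 2 * x) < 1) (hθl : thetaLoc (d + 1) L * (((L : ℝ) ^ (k + 1)) ^ 2 * x) < 1)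
    (hε : ((L : ℝ) ^ (k + 1)) ^ 2 * x ≤ 1)
    (hσ : 4 * (3 + 12 * ((d + 1 : ℕ) : ℝ)) ^ 2 * (L : ℝ) ^ (k + 1) * α₀ ≤ rho0 (d + 1) L ^ 2)
    (hS1 : (8 * (3 + 12 * ((d + 1 : ℕ) : ℝ)) * (2 + 2 * ((((d + 1 : ℕ) : ℝ) + 1) * L)
        * (1 + ((1250 * ((nbRad (d + 1) L : ℝ) + L) + 8 * (((d + 1 : ℕ) : ℝ) * L) + 2 * L) * (((d + 1 : ℕ) : ℝ) * (2 * nbRad (d + 1) L + 1) ^ (d + 1)))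
            / ((L : ℝ) / (L : ℝ) ^ (d + 1))))) * ((L : ℝ) ^ (k + 1) * α₀) ≤ 1)
    (hb : 256 * (((d + 1 : ℕ) : ℝ) + 1) * L * (3 + 12 * ((d + 1 : ℕ) : ℝ)) * ((L : ℝ) ^ (k + 1) * α₀) ≤ 1),
    SmallField U
      ((K * (2 * (curl1C (d + 1) L / (1 - thetaLoc (d + 1) L * (((L : ℝ) ^ (k + 1)) ^ 2 * x)))
                * (8 * (3 + 12 * ((d + 1 : ℕ) : ℝ)) * (2 + 2 * ((((d + 1 : ℕ) : ℝ) + 1) * L)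
                  * (1 + ((1250 * ((nbRad (d + 1) L : ℝ) + L) + 8 * (((d + 1 : ℕ) : ℝ) * L) + 2 * L)
                      * (((d + 1 : ℕ) : ℝ) * (2 * nbRad (d + 1) L + 1) ^ (d + 1))) / ((L : ℝ) / (L : ℝ) ^ (d + 1)))))
                * δ * ((L : ℝ) ^ (k + 1) * α₀)
              + (Fintype.card (T4AveragingDeficitWall.Plane (d + 1)) : ℝ)
                * (144 * (((L : ℝ) ^ (k + 1) * α₀) * αh1) + 5440 * ((L : ℝ) ^ (k + 1) * α₀) ^ 3 + 8 * (αh1 * αh1)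
                    + 304 * (αh1 * ((L : ℝ) ^ (k + 1) * α₀) ^ 2) + 2688 * ((L : ℝ) ^ (k + 1) * α₀) ^ 4))
          + Fintype.card n * (2 * (CdecD d * (((d : ℝ) + 1) * (2 * ((d : ℝ) + 1))
              * ((2 + 32 / (kappa163 (d + 1) / (d + 1)) ^ 2) * latticeConst (d + 1) (kappa163 (d + 1) / (d + 1) / 2)))))
            * (0 + 28 * ((3 + 12 * ((d + 1 : ℕ) : ℝ)) * ((L : ℝ) ^ (k + 1) * α₀)
                  + 4 * (3 + 12 * ((d + 1 : ℕ) : ℝ)) ^ 3 / rho0 (d + 1) L ^ 2 * ((L : ℝ) ^ (k + 1) * α₀) ^ 2) ^ 2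
                + 4 * (4 * (3 + 12 * ((d + 1 : ℕ) : ℝ)) ^ 3 / rho0 (d + 1) L ^ 2 * ((L : ℝ) ^ (k + 1) * α₀) ^ 2))
          + 28 * ((L : ℝ) ^ (k + 1) * α₀) ^ 2)
        / ((L : ℝ) ^ (k + 1)) ^ 2) := by
  obtain ⟨K, hK, h⟩ := smallField_of_trivialLetters_regauged (n := n) hd hL
  refine ⟨K, hK, ?_⟩
  intro N _ k U hU x δ hx hs hUx hδ hUδ hδx hcritU hflatTopU u₀ hu₀ hu₀P A₀ hgauge₀ hA₀P a₀ a₁ ω ha₀ ha₁ hω' hωd hβ α₀ α₁ αh1 hAα' hA1'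
    hα₁h hθ hθl hε hσ hS1 hb
  have hδM : 0 ≤ δ / ((L : ℝ) ^ (k + 1)) ^ 2 := by positivity
  have hsδ : LevelSmall (d + 1) L k (δ / ((L : ℝ) ^ (k + 1)) ^ 2) := hs.mono hδM hδx
  have hω : ∀ (z : Site (d + 1)) (i : Fin (d + 1)),
      ‖(u₀ (((L : ℤ) ^ (k + 1)) • (z + e i)) : Matrix n n ℂ) - u₀ (((L : ℤ) ^ (k + 1)) • z)‖ ≤ ω := fun z i =>
    (corner_oscillation_le hL k hU hδM hsδ hUδ hflatTopU hu₀ hgauge₀ ha₀ z i).trans hω'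
  exact h N k hU hx hs hUx hδ hUδ hcritU hflatTopU hu₀ hu₀P hgauge₀ hA₀P ha₀ ha₁ hω hωd hβ hAα' hA1' hα₁h hθ hθl hε hσ hS1 hb

end

end Summit.QuantumFields.BalabanUV.T4Continuum.NE7ApeTrivialFlatEndDischarged
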